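import Mathlib
import Summits.Ventures.PercRepro2.LeafAA0Reductions

/-!
# Row (LEAF-½) at the coincidences of `b` and `o` with the other marks
(blind cell PercRepro2, p5 g28; `proofs/P5-OEDGE.md` §38)

`LeafAA0Reductions.lean` settles the row when the explored mark `v` coincides with `a₁, a₂, b, o`.
Here the remaining coincidences of the two non-root marks are settled, each through the candidate
(AA0) `0 ≤ crossAA` (`LeafAA0.LeafRow_of_AA0`):

* `b = o` — `crossA = Q²·P(Q, vH, bL) − 2Q·P(Q, bL)·P(Q, vH, bL) + P(Q, bL)²·P(Q, vH)`
  `= P(Q, vH, bL)·(Q − P(Q, bL))² + P(Q, bL)²·(P(Q, vH) − P(Q, vH, bL)) ≥ 0` (the cleared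
  `Q³·E_Q[(L_b − β)² H_v]`), and the mirror likewise (**`crossAA_b_eq_o_nonneg`**);
* `b ∈ {a₁, a₂}` and `o ∈ {a₁, a₂}` — every term of `crossA` and of its mirror is either a mass of
  the sure event `{a ↔ a}` or a mass inside `{a₁ ↔ a₂} ∩ Q = ∅`, and `crossA = crossA′ = 0`
  (**`crossAA_b_root`**, **`crossAA_b_root'`**, **`crossAA_o_root`**, **`crossAA_o_root'`**).

Hence the row at these coincidences (**`LeafRow_b_eq_o`**, **`LeafRow_b_root`**,
**`LeafRow_b_root'`**, **`LeafRow_o_root`**, **`LeafRow_o_root'`**), and with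
`LeafRowCutOneFar.lean` the row whenever `b` (resp. `o`) is alone behind a cut vertex that is one
of the other marks. Nothing here claims the row in general.
-/

namespace Summit.Ventures.PercRepro2

open UnionCluster CovForm PendantRoot PendantO LeafStep LeafHalfCross

namespace LeafRowCoincidences

variable {V : Type*} {E : Type*} [Fintype E] [DecidableEq E] [Fintype V] [DecidableEq V]
  {R : Type*} [Field R] [LinearOrder R] [IsStrictOrderedRing R]

variable (p : E → R) (ends : E → Sym2 V)

/-! ## Two facts about the marks' events -/

section Facts

omit [Fintype E] [DecidableEq E] [Fintype V] [DecidableEq V] in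
/-- `{a ↔ a}` is the sure event. -/
lemma connEvent_self (a : V) : connEvent ends a a = Set.univ := by
  ext ω
  simp only [mem_connEvent, Set.mem_univ, iff_true]
  exact conn_refl ends ω a

omit [Fintype V] [DecidableEq V] [LinearOrder R] [IsStrictOrderedRing R] in
/-- A `Q`-mass inside `{a₂ ↔ a₁}` vanishes, for the event written in any position. -/
lemma mass_roots_zero (a₁ a₂ : V) {Y : Set (Config E)}
    (hY : ∀ ω ∈ Y, Conn ends ω a₂ a₁ ∨ Conn ends ω a₁ a₂) :
    prob p (avoidAll ends a₂ {a₁} ∩ Y) = 0 := by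
  have e : avoidAll ends a₂ {a₁} ∩ Y = ∅ := by
    ext ω
    simp only [Set.mem_inter_iff, avoidAll, Set.mem_setOf_eq, Finset.mem_singleton, forall_eq,
      Set.mem_empty_iff_false, iff_false, not_and]
    intro hQ hω
    rcases hY ω hω with h | h
    · exact hQ h
    · exact hQ (conn_symm h)
  rw [e, prob_empty]

end Facts

/-! ## `b = o` -/

section BeqO

omit [Fintype V] [DecidableEq V] in
/-- `0 ≤ crossA` at `b = o`: the cleared `Q³·E_Q[(L_b − β)² H_v]`. -/
theorem crossA_b_eq_o_nonneg (hp : IsProbVec p) (a₁ a₂ v b : V) :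
    0 ≤ crossA p ends b a₁ a₂ v b := by
  unfold crossA anticov
  rw [Set.inter_self]
  have hmono : prob p (avoidAll ends a₂ {a₁} ∩ (connEvent ends a₂ v ∩ connEvent ends a₁ b)) ≤
      prob p (avoidAll ends a₂ {a₁} ∩ connEvent ends a₂ v) :=
    prob_mono hp (Set.inter_subset_inter_right _ Set.inter_subset_left)
  have hx := prob_nonneg hp (avoidAll ends a₂ {a₁} ∩ (connEvent ends a₂ v ∩ connEvent ends a₁ b))
  set x := prob p (avoidAll ends a₂ {a₁} ∩ (connEvent ends a₂ v ∩ connEvent ends a₁ b))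
  set β := prob p (avoidAll ends a₂ {a₁} ∩ connEvent ends a₁ b)
  set π := prob p (avoidAll ends a₂ {a₁} ∩ connEvent ends a₂ v)
  set Q := prob p (avoidAll ends a₂ {a₁})
  have key : Q ^ 2 * x - Q * β * x + β * (π * β - Q * x) = x * (Q - β) ^ 2 + β ^ 2 * (π - x) := by
    ring
  rw [key]
  exact add_nonneg (mul_nonneg hx (sq_nonneg _)) (mul_nonneg (sq_nonneg _) (sub_nonneg.2 hmono))

omit [Fintype V] [DecidableEq V] in
/-- `0 ≤ crossAA` at `b = o`. -/
theorem crossAA_b_eq_o_nonneg (hp : IsProbVec p) (a₁ a₂ v b : V) :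
    0 ≤ crossAA p ends b a₁ a₂ v b :=
  add_nonneg (crossA_b_eq_o_nonneg p ends hp a₁ a₂ v b) (crossA_b_eq_o_nonneg p ends hp a₂ a₁ v b)

/-- **Row (LEAF-½) at `b = o`.** -/
theorem LeafRow_b_eq_o (hp : IsProbVec p) (a₁ a₂ v b : V) : LeafRow p ends b a₁ a₂ v b :=
  LeafRow_of_AA0 p ends hp b a₁ a₂ v b (crossAA_b_eq_o_nonneg p ends hp a₁ a₂ v b)

end BeqO

/-! ## `b` at a root -/

section BRoot

omit [Fintype V] [DecidableEq V] [LinearOrder R] [IsStrictOrderedRing R] in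
/-- `crossA = 0` at `b = a₁` (`{a₁ ↔ b}` is sure). -/
theorem crossA_b_eq_a1 (o a₁ a₂ v : V) : crossA p ends o a₁ a₂ v a₁ = 0 := by
  unfold crossA anticov
  simp only [connEvent_self, Set.inter_univ]
  ring

omit [Fintype V] [DecidableEq V] [LinearOrder R] [IsStrictOrderedRing R] in
/-- The mirror `crossA′ = 0` at `b = a₁` (`{a₂ ↔ b} ∩ Q = ∅`). -/
theorem crossA'_b_eq_a1 (o a₁ a₂ v : V) : crossA p ends o a₂ a₁ v a₁ = 0 := by
  unfold crossA anticov
  simp only [avoidAll_root_swap ends a₁ a₂]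
  rw [mass_roots_zero p ends a₁ a₂ (Y := connEvent ends a₁ v ∩ (connEvent ends a₂ o ∩
        connEvent ends a₂ a₁)) (fun ω hω => Or.inl hω.2.2),
    mass_roots_zero p ends a₁ a₂ (Y := connEvent ends a₂ a₁) (fun ω hω => Or.inl hω),
    mass_roots_zero p ends a₁ a₂ (Y := connEvent ends a₁ v ∩ connEvent ends a₂ a₁)
      (fun ω hω => Or.inl hω.2)]
  ring

omit [Fintype V] [DecidableEq V] [LinearOrder R] [IsStrictOrderedRing R] in
/-- `crossAA = 0` at `b = a₁`. -/
theorem crossAA_b_root' (o a₁ a₂ v : V) : crossAA p ends o a₁ a₂ v a₁ = 0 := by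
  unfold crossAA
  rw [crossA_b_eq_a1, crossA'_b_eq_a1, add_zero]

omit [Fintype V] [DecidableEq V] [LinearOrder R] [IsStrictOrderedRing R] in
/-- `crossA = 0` at `b = a₂` (`{a₁ ↔ b} ∩ Q = ∅`). -/
theorem crossA_b_eq_a2 (o a₁ a₂ v : V) : crossA p ends o a₁ a₂ v a₂ = 0 := by
  unfold crossA anticov
  rw [mass_roots_zero p ends a₁ a₂ (Y := connEvent ends a₂ v ∩ (connEvent ends a₁ o ∩
        connEvent ends a₁ a₂)) (fun ω hω => Or.inr hω.2.2),
    mass_roots_zero p ends a₁ a₂ (Y := connEvent ends a₁ a₂) (fun ω hω => Or.inr hω),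
    mass_roots_zero p ends a₁ a₂ (Y := connEvent ends a₂ v ∩ connEvent ends a₁ a₂)
      (fun ω hω => Or.inr hω.2)]
  ring

omit [Fintype V] [DecidableEq V] [LinearOrder R] [IsStrictOrderedRing R] in
/-- The mirror `crossA′ = 0` at `b = a₂` (`{a₂ ↔ b}` is sure). -/
theorem crossA'_b_eq_a2 (o a₁ a₂ v : V) : crossA p ends o a₂ a₁ v a₂ = 0 := by
  unfold crossA anticov
  simp only [connEvent_self, Set.inter_univ]
  ring

omit [Fintype V] [DecidableEq V] [LinearOrder R] [IsStrictOrderedRing R] in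
/-- `crossAA = 0` at `b = a₂`. -/
theorem crossAA_b_root (o a₁ a₂ v : V) : crossAA p ends o a₁ a₂ v a₂ = 0 := by
  unfold crossAA
  rw [crossA_b_eq_a2, crossA'_b_eq_a2, add_zero]

/-- **Row (LEAF-½) at `b = a₂`.** -/
theorem LeafRow_b_root (hp : IsProbVec p) (o a₁ a₂ v : V) : LeafRow p ends o a₁ a₂ v a₂ :=
  LeafRow_of_AA0 p ends hp o a₁ a₂ v a₂ (le_of_eq (crossAA_b_root p ends o a₁ a₂ v).symm)

/-- **Row (LEAF-½) at `b = a₁`.** -/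
theorem LeafRow_b_root' (hp : IsProbVec p) (o a₁ a₂ v : V) : LeafRow p ends o a₁ a₂ v a₁ :=
  LeafRow_of_AA0 p ends hp o a₁ a₂ v a₁ (le_of_eq (crossAA_b_root' p ends o a₁ a₂ v).symm)

end BRoot

/-! ## `o` at a root -/

section ORoot

omit [Fintype V] [DecidableEq V] [LinearOrder R] [IsStrictOrderedRing R] in
/-- `crossA = 0` at `o = a₁` (`{a₁ ↔ o}` is sure). -/
theorem crossA_o_eq_a1 (a₁ a₂ v b : V) : crossA p ends a₁ a₁ a₂ v b = 0 := by
  unfold crossA anticov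
  simp only [connEvent_self, Set.univ_inter, Set.inter_univ]
  ring

omit [Fintype V] [DecidableEq V] [LinearOrder R] [IsStrictOrderedRing R] in
/-- The mirror `crossA′ = 0` at `o = a₁` (`{a₂ ↔ o} ∩ Q = ∅`). -/
theorem crossA'_o_eq_a1 (a₁ a₂ v b : V) : crossA p ends a₁ a₂ a₁ v b = 0 := by
  unfold crossA anticov
  simp only [avoidAll_root_swap ends a₁ a₂]
  rw [mass_roots_zero p ends a₁ a₂ (Y := connEvent ends a₁ v ∩ (connEvent ends a₂ a₁ ∩
        connEvent ends a₂ b)) (fun ω hω => Or.inl hω.2.1),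
    mass_roots_zero p ends a₁ a₂ (Y := connEvent ends a₁ v ∩ connEvent ends a₂ a₁)
      (fun ω hω => Or.inl hω.2),
    mass_roots_zero p ends a₁ a₂ (Y := connEvent ends a₂ a₁) (fun ω hω => Or.inl hω)]
  ring

omit [Fintype V] [DecidableEq V] [LinearOrder R] [IsStrictOrderedRing R] in
/-- `crossAA = 0` at `o = a₁`. -/
theorem crossAA_o_root' (a₁ a₂ v b : V) : crossAA p ends a₁ a₁ a₂ v b = 0 := by
  unfold crossAA
  rw [crossA_o_eq_a1, crossA'_o_eq_a1, add_zero]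

omit [Fintype V] [DecidableEq V] [LinearOrder R] [IsStrictOrderedRing R] in
/-- `crossA = 0` at `o = a₂` (`{a₁ ↔ o} ∩ Q = ∅`). -/
theorem crossA_o_eq_a2 (a₁ a₂ v b : V) : crossA p ends a₂ a₁ a₂ v b = 0 := by
  unfold crossA anticov
  rw [mass_roots_zero p ends a₁ a₂ (Y := connEvent ends a₂ v ∩ (connEvent ends a₁ a₂ ∩
        connEvent ends a₁ b)) (fun ω hω => Or.inr hω.2.1),
    mass_roots_zero p ends a₁ a₂ (Y := connEvent ends a₂ v ∩ connEvent ends a₁ a₂)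
      (fun ω hω => Or.inr hω.2),
    mass_roots_zero p ends a₁ a₂ (Y := connEvent ends a₁ a₂) (fun ω hω => Or.inr hω)]
  ring

omit [Fintype V] [DecidableEq V] [LinearOrder R] [IsStrictOrderedRing R] in
/-- The mirror `crossA′ = 0` at `o = a₂` (`{a₂ ↔ o}` is sure). -/
theorem crossA'_o_eq_a2 (a₁ a₂ v b : V) : crossA p ends a₂ a₂ a₁ v b = 0 := by
  unfold crossA anticov
  simp only [connEvent_self, Set.univ_inter, Set.inter_univ]
  ring

omit [Fintype V] [DecidableEq V] [LinearOrder R] [IsStrictOrderedRing R] in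
/-- `crossAA = 0` at `o = a₂`. -/
theorem crossAA_o_root (a₁ a₂ v b : V) : crossAA p ends a₂ a₁ a₂ v b = 0 := by
  unfold crossAA
  rw [crossA_o_eq_a2, crossA'_o_eq_a2, add_zero]

/-- **Row (LEAF-½) at `o = a₂`.** -/
theorem LeafRow_o_root (hp : IsProbVec p) (a₁ a₂ v b : V) : LeafRow p ends a₂ a₁ a₂ v b :=
  LeafRow_of_AA0 p ends hp a₂ a₁ a₂ v b (le_of_eq (crossAA_o_root p ends a₁ a₂ v b).symm)

/-- **Row (LEAF-½) at `o = a₁`.** -/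
theorem LeafRow_o_root' (hp : IsProbVec p) (a₁ a₂ v b : V) : LeafRow p ends a₁ a₁ a₂ v b :=
  LeafRow_of_AA0 p ends hp a₁ a₁ a₂ v b (le_of_eq (crossAA_o_root' p ends a₁ a₂ v b).symm)

end ORoot

end LeafRowCoincidences

end Summit.Ventures.PercRepro2
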